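import Summits.NavierStokesRegularity.NavierStokesRegularity.Theorems.TypeILiouvilleTypeIliouvilleNoTypeIITypeIIZoomPackage
import Summits.NavierStokesRegularity.NavierStokesRegularity.Theorems.TypeILiouvilleTypeIliouvilleNoTypeIIEternalInheritance
import HarnessLib

/-!
# Crux `TypeIliouvilleNoTypeII` (stmt-NavierStokesRegularity-0056), line `eternal_split`, stub
# `stub_eternalProfileOfTypeII` — VELOCITY-SIDE INHERITANCE, part 2: transport along the window zooms
# and the TRANSFER of a pressure-free Type-I bound to the Type-II zoom limit

Helper file (theorems only) for the Type-II-exclusion estimate programme (D-0081 §B), on top of the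
Type-II zoom package (`…TypeIIZoomPackage.lean`, `exists_typeIIZoomPackage`: windows `w_j`, limit
`v`, pointwise convergence of values and gradients) and of part 1 (`…EternalInheritance.lean`: the
scaled quantities `A = cknAEss`, `C = cknC`, `E = cknE` do not jump up in such limits).

* TRANSPORT (`cknAEss_windowZoom`, `cknC_windowZoom`, `fderiv_windowZoom_eq`, `cknE_windowZoom`):
  for the window zoom `w = M⁻¹ u(t₀ + sν/M², x₀ + yν/M)` and every ball `Q(z, r)`,
  `X(w; Q(z, r)) = X(ũ; Q(Φ z, (ν/M) r))` for `X ∈ {A, C, E}`, where `ũ(s, x) = ν⁻¹ u(s/ν, x)` is the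
  viscosity-normalised field and `Φ = stAffine ((ν/M)²) (ν/M) (ν t₀) x₀` (the tree's scale invariance
  `cknAEss_nsZoom` / `cknC_nsZoom` / `cknE_nsZoom` and `windowZoom_eq_smul_stPull_timeRescale`);
* LOCATION of the image balls (`image_ball_subset_slab`): if the rescaled times of `Q(z, r)` lie in
  the rescaled window `(-k, k)` and the physical window lies in `(a, T)`, the image ball lies in the
  slab `(νa, νT) × ℝ³` of `ũ`;
* TRANSFER (`transfer_pressureFreeBound`): if `A`, `C`, `E` of `(ũ, ∇ũ)` are bounded by `I` on every
  ball of a final slab `(S₁, νT) × ℝ³`, `S₁ < νT`, then along the package data the limit `v` has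
  `A, C, E ≤ I` on EVERY ball of `ℝ × ℝ³` — the TRANSFER hypothesis of
  `isTypeIBlowup_of_transfer_of_rigidity` for the property «pressure-free Type-I quantity bounded»;
* `exists_eternalProfile_pressureFree_of_not_isTypeIBlowup`: a Type-II blow-up whose normalised
  solution has bounded pressure-free Type-I quantity on a final slab generates a bounded eternal
  Oseen-mild smooth divergence-free `v`, `‖v‖ ≤ 2`, `‖v(0,0)‖ ≥ 1/2`, with `A, C, E ≤ I` on all balls —
  a NON-DEGENERATE profile: nonzero constant flows have `A(Q_r) → ∞` (critic-2's model row M10 is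
  excluded by the `A`-bound alone); the pressure side (classical pressure, `D`, full `𝐈 < ∞`) of the
  registered stub is not touched here.

WHAT THIS IS NOT: not NS; no Liouville theorem, nothing about the crux itself. [folklore]
-/

noncomputable section

-- the summit and its single problem share the name (D-0017 nested layout)
set_option linter.dupNamespace false

open MeasureTheory Set Function Filter TopologicalSpace Metric
open scoped Topology NNReal ENNReal

namespace Summit.NavierStokesRegularity.NavierStokesRegularity.Theorems.TypeIliouvilleNoTypeII.EternalSplit

open Literature.Analysis Literature.Analysis.FluidPDE
open Summit.NavierStokesRegularity.NavierStokesRegularity.Theorems.TypeIliouvilleNoTypeII.ImmortalZoom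
open Summit.NavierStokesRegularity.NavierStokesRegularity.Theorems.TypeIliouvilleNoTypeII.TypeIIZoom

variable {ν T M t₀ : ℝ} {u : ℝ → EuclideanSpace ℝ (Fin 3) → EuclideanSpace ℝ (Fin 3)}
  {p : ℝ → EuclideanSpace ℝ (Fin 3) → ℝ} {x₀ : EuclideanSpace ℝ (Fin 3)}

/-! ### Transport of `A`, `C`, `E` along one window zoom -/

/-- **Transport of `A`**: `A(w; Q(z, r)) = A(ũ; Q(Φ z, (ν/M) r))` for the window zoom `w` of `u` and
the viscosity-normalised `ũ = timeRescale ν⁻¹ ν⁻¹ u`. [folklore] -/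
theorem cknAEss_windowZoom (hν : 0 < ν) (hM : 0 < M) {r : ℝ} (hr : 0 < r)
    (z : ℝ × EuclideanSpace ℝ (Fin 3)) :
    cknAEss r z (M⁻¹ • stPull (ν / M ^ 2) (ν / M) t₀ x₀ u) =
      cknAEss (ν / M * r) (stAffine ((ν / M) ^ 2) (ν / M) (ν * t₀) x₀ z) (timeRescale ν⁻¹ ν⁻¹ u) := by
  rw [windowZoom_eq_smul_stPull_timeRescale hν hM]
  exact cknAEss_nsZoom (div_pos hν hM) hr _ _ _ _

/-- **Transport of `C`**: `C(w; Q(z, r)) = C(ũ; Q(Φ z, (ν/M) r))`. [folklore] -/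
theorem cknC_windowZoom (hν : 0 < ν) (hM : 0 < M) {r : ℝ} (hr : 0 < r)
    (z : ℝ × EuclideanSpace ℝ (Fin 3)) :
    cknC r z (M⁻¹ • stPull (ν / M ^ 2) (ν / M) t₀ x₀ u) =
      cknC (ν / M * r) (stAffine ((ν / M) ^ 2) (ν / M) (ν * t₀) x₀ z) (timeRescale ν⁻¹ ν⁻¹ u) := by
  rw [windowZoom_eq_smul_stPull_timeRescale hν hM]
  exact cknC_nsZoom (div_pos hν hM) hr _ _ _ _

/-- **The gradient of the window zoom is the zoom of the gradient**: as space–time fields,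
`∇w = (ν/M)² • stPull ((ν/M)²) (ν/M) (ν t₀) x₀ ∇ũ` (chain rule; no differentiability needed). [folklore] -/
theorem fderiv_windowZoom_eq (hν : 0 < ν) (hM : 0 < M) :
    (fun s y => fderiv ℝ ((M⁻¹ • stPull (ν / M ^ 2) (ν / M) t₀ x₀ u) s) y) =
      (ν / M) ^ 2 • stPull ((ν / M) ^ 2) (ν / M) (ν * t₀) x₀
        (fun s y => fderiv ℝ (timeRescale ν⁻¹ ν⁻¹ u s) y) := by
  funext s y
  rw [windowZoom_eq_smul_stPull_timeRescale hν hM]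
  have h1 : ((ν / M) • stPull ((ν / M) ^ 2) (ν / M) (ν * t₀) x₀ (timeRescale ν⁻¹ ν⁻¹ u)) s =
      (ν / M) • stPull ((ν / M) ^ 2) (ν / M) (ν * t₀) x₀ (timeRescale ν⁻¹ ν⁻¹ u) s := rfl
  rw [h1, fderiv_const_smul_field, Pi.smul_apply, fderiv_stPull, smul_smul, ← pow_two]
  simp only [Pi.smul_apply, stPull_apply]

/-- **Transport of `E`**: `E(∇w; Q(z, r)) = E(∇ũ; Q(Φ z, (ν/M) r))`. [folklore] -/
theorem cknE_windowZoom (hν : 0 < ν) (hM : 0 < M) {r : ℝ} (hr : 0 < r)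
    (z : ℝ × EuclideanSpace ℝ (Fin 3)) :
    cknE r z (fun s y => fderiv ℝ ((M⁻¹ • stPull (ν / M ^ 2) (ν / M) t₀ x₀ u) s) y) =
      cknE (ν / M * r) (stAffine ((ν / M) ^ 2) (ν / M) (ν * t₀) x₀ z)
        (fun s y => fderiv ℝ (timeRescale ν⁻¹ ν⁻¹ u s) y) := by
  rw [fderiv_windowZoom_eq hν hM]
  exact cknE_nsZoom (div_pos hν hM) hr _ _ _ _

/-! ### Where the image balls sit -/

/-- Physical times of the rescaled window, general left end: if `[t₀ - kν/M², t₀ + kν/M²] ⊆ (a, T)`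
and `-k < s < k` then `t₀ + (ν/M²) s ∈ (a, T)`. [folklore] -/
theorem windowZoom_time_mem' (hν : 0 < ν) (hM : 0 < M) {k a : ℝ}
    (hsub : Icc (t₀ - k * ν / M ^ 2) (t₀ + k * ν / M ^ 2) ⊆ Ioo a T) {s : ℝ} (hs : s ∈ Ioo (-k) k) :
    t₀ + ν / M ^ 2 * s ∈ Ioo a T := by
  have hc : 0 < ν / M ^ 2 := by positivity
  refine hsub ⟨?_, ?_⟩
  · have h := mul_lt_mul_of_pos_left hs.1 hc
    have e : ν / M ^ 2 * -k = -(k * ν / M ^ 2) := by ring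
    linarith [e]
  · have h := mul_lt_mul_of_pos_left hs.2 hc
    have e : ν / M ^ 2 * k = k * ν / M ^ 2 := by ring
    linarith [e]

/-- **The image ball lies in the slab.** If the rescaled times `(z.1 - r², z.1)` of `Q(z, r)` lie in
`[-k', k']` with `k' < k`, and the physical window of half-length `k` lies in `(a, T)`, then the image
ball `Q(Φ z, (ν/M) r)` lies in the slab `(νa, νT) × ℝ³` of the normalised field. [folklore] -/
theorem image_ball_subset_slab (hν : 0 < ν) (hM : 0 < M) {k a r : ℝ}
    (hsub : Icc (t₀ - k * ν / M ^ 2) (t₀ + k * ν / M ^ 2) ⊆ Ioo a T)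
    {z : ℝ × EuclideanSpace ℝ (Fin 3)} (hz1 : -k < z.1 - r ^ 2) (hz2 : z.1 < k) :
    parabolicCylinder (ν / M * r) (stAffine ((ν / M) ^ 2) (ν / M) (ν * t₀) x₀ z) ⊆
      Ioo (ν * a) (ν * T) ×ˢ univ := by
  intro w hw
  rw [mem_parabolicCylinder, stAffine_fst] at hw
  obtain ⟨⟨h1, h2⟩, -⟩ := hw
  refine ⟨?_, mem_univ _⟩
  -- `w.1 = ν t₀ + (ν/M)² s` with `s ∈ (z.1 - r², z.1) ⊆ (-k, k)`
  set s : ℝ := (w.1 - ν * t₀) / (ν / M) ^ 2 with hs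
  have hc : 0 < (ν / M) ^ 2 := by positivity
  have hw1 : w.1 = ν * t₀ + (ν / M) ^ 2 * s := by rw [hs]; field_simp; ring
  have hs1 : z.1 - r ^ 2 < s := by
    rw [hs, lt_div_iff₀ hc]
    have e : (ν / M * r) ^ 2 = (ν / M) ^ 2 * r ^ 2 := by ring
    nlinarith [h1, e]
  have hs2 : s < z.1 := by
    rw [hs, div_lt_iff₀ hc]; nlinarith [h2]
  have hsI : s ∈ Ioo (-k) k := ⟨hz1.trans hs1, hs2.trans hz2⟩
  have hphys := windowZoom_time_mem' (t₀ := t₀) hν hM hsub hsI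
  have e : ν * t₀ + (ν / M) ^ 2 * s = ν * (t₀ + ν / M ^ 2 * s) := by ring
  rw [hw1, e]
  exact ⟨mul_lt_mul_of_pos_left hphys.1 hν, mul_lt_mul_of_pos_left hphys.2 hν⟩

/-! ### Regularity of the window zoom on a ball inside the rescaled window -/

/-- The window zoom is jointly continuous on every ball whose times lie in the rescaled window.
[folklore] -/
theorem windowZoom_continuousOn_ball (hν : 0 < ν) (hsol : IsClassicalNSSolutionOn (Ico 0 T) ν 0 u p)
    (hM : 0 < M) {k r : ℝ} (hsub : Icc (t₀ - k * ν / M ^ 2) (t₀ + k * ν / M ^ 2) ⊆ Ioo 0 T)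
    {z : ℝ × EuclideanSpace ℝ (Fin 3)} (hz1 : -k ≤ z.1 - r ^ 2) (hz2 : z.1 ≤ k) :
    ContinuousOn (uncurry (M⁻¹ • stPull (ν / M ^ 2) (ν / M) t₀ x₀ u)) (parabolicCylinder r z) :=
  (windowZoom_continuousOn (x₀ := x₀) hν hsol hM hsub).mono
    (prod_mono (fun _ hs => ⟨lt_of_le_of_lt hz1 hs.1, lt_of_lt_of_le hs.2 hz2⟩) (subset_univ _))

/-- The gradient of the window zoom is jointly continuous on every ball whose times lie in the
rescaled window. [folklore] -/
theorem windowZoom_continuousOn_fderiv_ball (hν : 0 < ν)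
    (hsol : IsClassicalNSSolutionOn (Ico 0 T) ν 0 u p)
    (hM : 0 < M) {k r : ℝ} (hsub : Icc (t₀ - k * ν / M ^ 2) (t₀ + k * ν / M ^ 2) ⊆ Ioo 0 T)
    {z : ℝ × EuclideanSpace ℝ (Fin 3)} (hz1 : -k ≤ z.1 - r ^ 2) (hz2 : z.1 ≤ k) :
    ContinuousOn (fun q : ℝ × EuclideanSpace ℝ (Fin 3) =>
      fderiv ℝ ((M⁻¹ • stPull (ν / M ^ 2) (ν / M) t₀ x₀ u) q.1) q.2) (parabolicCylinder r z) :=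
  ((windowZoom_isClassical (x₀ := x₀) hν hsol hM hsub).smooth_velocity.continuousOn_fderiv_slice
    isOpen_Ioo.uniqueDiffOn).mono
    (prod_mono (fun _ hs => ⟨lt_of_le_of_lt hz1 hs.1, lt_of_lt_of_le hs.2 hz2⟩) (subset_univ _))

/-! ### The transfer theorem -/

/-- **TRANSFER of a pressure-free Type-I bound to the Type-II zoom limit.**  Let `(u, p)` be a
classical solution on `ℝ³ × [0, T)` and suppose the viscosity-normalised field
`ũ = timeRescale ν⁻¹ ν⁻¹ u` has `A`, `C`, `E` (for the classical gradient) bounded by `I` on every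
parabolic ball of a final slab `(S₁, νT) × ℝ³`, `S₁ < νT`.  Then along ANY data of the shape exported
by the Type-II zoom package — windows of half-length `j` in the final slabs `(T - T/(j+1), T)` with
`‖u‖ ≤ 2M_j`, zooms converging with their gradients at every point to `v` — the limit has
`A(v; Q) ≤ I`, `C(v; Q) ≤ I`, `E(∇v; Q) ≤ I` on EVERY ball `Q = Q(z, r)`, `r > 0`, of `ℝ × ℝ³`.
This is the TRANSFER hypothesis of `isTypeIBlowup_of_transfer_of_rigidity` for the property
«pressure-free Type-I quantity bounded by `I`». [folklore] -/
theorem transfer_pressureFreeBound (hν : 0 < ν) (hT : 0 < T)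
    (hsol : IsClassicalNSSolutionOn (Ico 0 T) ν 0 u p) {S₁ : ℝ} (hS₁ : S₁ < ν * T) {I : ℝ≥0∞}
    (hA : ∀ r : ℝ, 0 < r → ∀ z : ℝ × EuclideanSpace ℝ (Fin 3),
      parabolicCylinder r z ⊆ Ioo S₁ (ν * T) ×ˢ univ → cknAEss r z (timeRescale ν⁻¹ ν⁻¹ u) ≤ I)
    (hC : ∀ r : ℝ, 0 < r → ∀ z : ℝ × EuclideanSpace ℝ (Fin 3),
      parabolicCylinder r z ⊆ Ioo S₁ (ν * T) ×ˢ univ → cknC r z (timeRescale ν⁻¹ ν⁻¹ u) ≤ I)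
    (hE : ∀ r : ℝ, 0 < r → ∀ z : ℝ × EuclideanSpace ℝ (Fin 3),
      parabolicCylinder r z ⊆ Ioo S₁ (ν * T) ×ˢ univ →
      cknE r z (fun s y => fderiv ℝ (timeRescale ν⁻¹ ν⁻¹ u s) y) ≤ I)
    {tc M : ℕ → ℝ} {xc : ℕ → EuclideanSpace ℝ (Fin 3)}
    {v : ℝ → EuclideanSpace ℝ (Fin 3) → EuclideanSpace ℝ (Fin 3)}
    (hM : ∀ j, 0 < M j)
    (hsub : ∀ j : ℕ, Icc (tc j - j * ν / M j ^ 2) (tc j + j * ν / M j ^ 2) ⊆ Ioo (T - T / (j + 1)) T)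
    (hbd : ∀ j : ℕ, ∀ s ∈ Icc (tc j - j * ν / M j ^ 2) (tc j + j * ν / M j ^ 2), ∀ x,
      ‖u s x‖ ≤ 2 * M j)
    (hval : ∀ s y, Tendsto (fun j => ((M j)⁻¹ • stPull (ν / M j ^ 2) (ν / M j) (tc j) (xc j) u) s y)
      atTop (𝓝 (v s y)))
    (hgrad : ∀ s y, Tendsto
      (fun j => fderiv ℝ (((M j)⁻¹ • stPull (ν / M j ^ 2) (ν / M j) (tc j) (xc j) u) s) y)
      atTop (𝓝 (fderiv ℝ (v s) y))) :
    ∀ r : ℝ, 0 < r → ∀ z : ℝ × EuclideanSpace ℝ (Fin 3),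
      cknAEss r z v ≤ I ∧ cknC r z v ≤ I ∧ cknE r z (fun s y => fderiv ℝ (v s) y) ≤ I := by
  intro r hr z
  -- the windows lie in `(0, T)` as well
  have hslab : ∀ j : ℕ, 0 ≤ T - T / (j + 1) := fun j => by
    have h1 : T / (j + 1) ≤ T := div_le_self hT.le (le_add_of_nonneg_left (Nat.cast_nonneg j))
    linarith
  have hsub0 : ∀ j : ℕ, Icc (tc j - j * ν / M j ^ 2) (tc j + j * ν / M j ^ 2) ⊆ Ioo 0 T :=
    fun j s hs => ⟨(hslab j).trans_lt (hsub j hs).1, (hsub j hs).2⟩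
  -- eventually: the rescaled times of the ball lie in `[-(j-1), j-1]`, and `ν (T - T/(j+1)) ≥ S₁`
  have hev1 : ∀ᶠ j : ℕ in atTop, -((j : ℝ) - 1) ≤ z.1 - r ^ 2 ∧ z.1 ≤ (j : ℝ) - 1 := by
    obtain ⟨n, hn⟩ := exists_nat_ge (|z.1| + r ^ 2 + 1)
    refine eventually_atTop.2 ⟨n, fun j hj => ?_⟩
    have hj' : (n : ℝ) ≤ j := by exact_mod_cast hj
    constructor <;> cases abs_cases z.1 <;> nlinarith [sq_nonneg r]
  have hev2 : ∀ᶠ j : ℕ in atTop, S₁ ≤ ν * (T - T / ((j : ℝ) + 1)) := by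
    have h0 : Tendsto (fun j : ℕ => T / ((j : ℝ) + 1)) atTop (𝓝 0) := by
      have h := tendsto_one_div_add_atTop_nhds_zero_nat.const_mul T
      rw [mul_zero] at h
      exact h.congr fun j => by ring
    have ht : Tendsto (fun j : ℕ => ν * (T - T / ((j : ℝ) + 1))) atTop (𝓝 (ν * (T - 0))) :=
      (h0.const_sub T).const_mul ν
    rw [sub_zero] at ht
    exact ht.eventually (eventually_ge_nhds hS₁)
  have hev := hev1.and hev2
  -- the eventual hypotheses of part 1, for the zooms `w_j`
  have hcont : ∀ᶠ j : ℕ in atTop, ContinuousOn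
      (uncurry ((M j)⁻¹ • stPull (ν / M j ^ 2) (ν / M j) (tc j) (xc j) u)) (parabolicCylinder r z) := by
    filter_upwards [hev] with j hj
    exact windowZoom_continuousOn_ball hν hsol (hM j) (hsub0 j) (by linarith [hj.1.1]) (by linarith [hj.1.2])
  have hgcont : ∀ᶠ j : ℕ in atTop, ContinuousOn (fun q : ℝ × EuclideanSpace ℝ (Fin 3) =>
      fderiv ℝ (((M j)⁻¹ • stPull (ν / M j ^ 2) (ν / M j) (tc j) (xc j) u) q.1) q.2)
      (parabolicCylinder r z) := by
    filter_upwards [hev] with j hj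
    exact windowZoom_continuousOn_fderiv_ball hν hsol (hM j) (hsub0 j) (by linarith [hj.1.1])
      (by linarith [hj.1.2])
  have hbdw : ∀ᶠ j : ℕ in atTop, ∀ q ∈ parabolicCylinder r z,
      ‖((M j)⁻¹ • stPull (ν / M j ^ 2) (ν / M j) (tc j) (xc j) u) q.1 q.2‖ ≤ 2 := by
    filter_upwards [hev] with j hj q hq
    rw [mem_parabolicCylinder] at hq
    exact windowZoom_norm_le_of_le_mul hν (hM j) (hbd j) ⟨by linarith [hj.1.1, hq.1.1],
      by linarith [hj.1.2, hq.1.2]⟩ q.2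
  -- the image balls lie in the slab `(S₁, νT) × ℝ³`
  have himg : ∀ᶠ j : ℕ in atTop,
      parabolicCylinder (ν / M j * r) (stAffine ((ν / M j) ^ 2) (ν / M j) (ν * tc j) (xc j) z) ⊆
        Ioo S₁ (ν * T) ×ˢ univ := by
    filter_upwards [hev] with j hj
    refine (image_ball_subset_slab (x₀ := xc j) hν (hM j) (hsub j) (by linarith [hj.1.1])
      (by linarith [hj.1.2])).trans (prod_mono (Ioo_subset_Ioo_left hj.2) Subset.rfl)
  have hlimQ : ∀ q ∈ parabolicCylinder r z, Tendsto
      (fun j => ((M j)⁻¹ • stPull (ν / M j ^ 2) (ν / M j) (tc j) (xc j) u) q.1 q.2) atTop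
      (𝓝 (v q.1 q.2)) := fun q _ => hval q.1 q.2
  have hglimQ : ∀ q ∈ parabolicCylinder r z, Tendsto
      (fun j => fderiv ℝ (((M j)⁻¹ • stPull (ν / M j ^ 2) (ν / M j) (tc j) (xc j) u) q.1) q.2) atTop
      (𝓝 (fderiv ℝ (v q.1) q.2)) := fun q _ => hgrad q.1 q.2
  refine ⟨?_, ?_, ?_⟩
  · refine cknAEss_le_of_tendsto hr hcont hbdw hlimQ ?_
    filter_upwards [himg] with j hj
    rw [cknAEss_windowZoom hν (hM j) hr]
    exact hA _ (mul_pos (div_pos hν (hM j)) hr) _ hj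
  · refine cknC_le_of_tendsto hr hcont hbdw hlimQ ?_
    filter_upwards [himg] with j hj
    rw [cknC_windowZoom hν (hM j) hr]
    exact hC _ (mul_pos (div_pos hν (hM j)) hr) _ hj
  · refine cknE_le_of_tendsto hr hgcont hglimQ ?_
    filter_upwards [himg] with j hj
    rw [cknE_windowZoom hν (hM j) hr]
    exact hE _ (mul_pos (div_pos hν (hM j)) hr) _ hj

/-- **A Type-II blow-up with a pressure-free Type-I bound generates a NON-DEGENERATE eternal
profile.**  Let `(u, p)` be a maximal smooth solution with lifespan `T`, Leray–Hopf from a rapidly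
decaying datum, NOT Type I at `T`, whose viscosity-normalised field `ũ = timeRescale ν⁻¹ ν⁻¹ u` has
`A`, `C`, `E` bounded by `I` on every ball of a final slab `(S₁, νT) × ℝ³`.  Then there is a bounded
ETERNAL Oseen-mild smooth divergence-free `v` on `ℝ × ℝ³` with `‖v‖ ≤ 2`, `‖v(0, 0)‖ ≥ 1/2` and
`A(v; Q) ≤ I`, `C(v; Q) ≤ I`, `E(∇v; Q) ≤ I` on EVERY parabolic ball `Q` (the Type-II zoom package +
`transfer_pressureFreeBound`).  For `I < ⊤` the `A`-bound excludes nonzero constant limits. [folklore] -/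
theorem exists_eternalProfile_pressureFree_of_not_isTypeIBlowup (hν : 0 < ν) (hT : 0 < T)
    (hmax : IsMaximalSmoothSolution ν 0 u p T) (hLH : IsLerayHopfOn T ν 0 (u 0) u)
    (hdec : HasRapidSpatialDecay (u 0)) (hII : ¬ IsTypeIBlowup u T) {S₁ : ℝ} (hS₁ : S₁ < ν * T)
    {I : ℝ≥0∞}
    (hA : ∀ r : ℝ, 0 < r → ∀ z : ℝ × EuclideanSpace ℝ (Fin 3),
      parabolicCylinder r z ⊆ Ioo S₁ (ν * T) ×ˢ univ → cknAEss r z (timeRescale ν⁻¹ ν⁻¹ u) ≤ I)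
    (hC : ∀ r : ℝ, 0 < r → ∀ z : ℝ × EuclideanSpace ℝ (Fin 3),
      parabolicCylinder r z ⊆ Ioo S₁ (ν * T) ×ˢ univ → cknC r z (timeRescale ν⁻¹ ν⁻¹ u) ≤ I)
    (hE : ∀ r : ℝ, 0 < r → ∀ z : ℝ × EuclideanSpace ℝ (Fin 3),
      parabolicCylinder r z ⊆ Ioo S₁ (ν * T) ×ˢ univ →
      cknE r z (fun s y => fderiv ℝ (timeRescale ν⁻¹ ν⁻¹ u s) y) ≤ I) :
    ∃ v : ℝ → EuclideanSpace ℝ (Fin 3) → EuclideanSpace ℝ (Fin 3),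
      ContDiff ℝ (⊤ : ℕ∞) (uncurry v) ∧ (∀ t, VectorCalculus.IsDivFree (v t)) ∧
      (∀ s t : ℝ, s < t → ∀ x, v t x = heatFlow (v s) (t - s) x - oseenDuhamel 1 s v v t x) ∧
      (∀ t x, ‖v t x‖ ≤ 2) ∧ 1 / 2 ≤ ‖v 0 0‖ ∧
      (∀ r : ℝ, 0 < r → ∀ z : ℝ × EuclideanSpace ℝ (Fin 3),
        cknAEss r z v ≤ I ∧ cknC r z v ≤ I ∧ cknE r z (fun s y => fderiv ℝ (v s) y) ≤ I) := by
  obtain ⟨tc, M, xc, v, hM, hsub, hbd, -, hv, hdiv, hmild, hvbd, h0, hval, hgrad⟩ :=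
    exists_typeIIZoomPackage ν T hν hT u p hmax hLH hdec hII
  exact ⟨v, hv, hdiv, hmild, hvbd, h0,
    transfer_pressureFreeBound hν hT hmax.1 hS₁ hA hC hE hM hsub hbd hval hgrad⟩

/-! ### Non-degeneracy: the `A`-bound excludes nonzero constant limits -/

/-- **`A` of a constant field**: `A(b; Q(z, r)) = r² ‖b‖² |B₁|` — the scaled slice energy of a nonzero
constant grows quadratically with the radius. [folklore] -/
theorem cknAEss_const {r : ℝ} (hr : 0 < r) (z : ℝ × EuclideanSpace ℝ (Fin 3))
    (b : EuclideanSpace ℝ (Fin 3)) :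
    cknAEss r z (fun _ _ => b) =
      ENNReal.ofReal (r ^ 2) * (‖b‖ₑ ^ 2 * volume (ball (0 : EuclideanSpace ℝ (Fin 3)) 1)) := by
  unfold cknAEss
  have hμ : volume.restrict (Ioo (z.1 - r ^ 2) z.1) ≠ 0 := by
    rw [Ne, Measure.restrict_eq_zero, Real.volume_Ioo, ENNReal.ofReal_eq_zero, not_le]
    nlinarith
  show essSup (fun _ : ℝ => (ENNReal.ofReal r)⁻¹ *
      ∫⁻ x in ball z.2 r, ‖b‖ₑ ^ 2) (volume.restrict (Ioo (z.1 - r ^ 2) z.1)) = _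
  rw [essSup_const _ hμ, lintegral_const, Measure.restrict_apply_univ,
    Measure.addHaar_ball_of_pos volume z.2 hr, finrank_euclideanSpace_fin]
  have h : (ENNReal.ofReal r)⁻¹ * ENNReal.ofReal (r ^ 3) = ENNReal.ofReal (r ^ 2) := by
    rw [show r ^ 3 = r * r ^ 2 by ring, ENNReal.ofReal_mul hr.le, ← mul_assoc,
      ENNReal.inv_mul_cancel (ENNReal.ofReal_pos.2 hr).ne' ENNReal.ofReal_ne_top, one_mul]
  calc (ENNReal.ofReal r)⁻¹ *
        (‖b‖ₑ ^ 2 * (ENNReal.ofReal (r ^ 3) * volume (ball (0 : EuclideanSpace ℝ (Fin 3)) 1)))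
      = ((ENNReal.ofReal r)⁻¹ * ENNReal.ofReal (r ^ 3)) *
          (‖b‖ₑ ^ 2 * volume (ball (0 : EuclideanSpace ℝ (Fin 3)) 1)) := by ring
    _ = _ := by rw [h]

/-- **The `A`-bound excludes nonzero constants**: a field with `A(v; Q) ≤ I < ⊤` on every parabolic
ball is not a nonzero constant flow (critic-2's model row M10 — constant eternal mild solutions,
KNSS 2009 §1 — is outside the class of limits produced by `transfer_pressureFreeBound`). [folklore] -/
theorem ne_const_of_cknAEss_le {v : ℝ → EuclideanSpace ℝ (Fin 3) → EuclideanSpace ℝ (Fin 3)}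
    {I : ℝ≥0∞} (hI : I ≠ ⊤)
    (hA : ∀ r : ℝ, 0 < r → ∀ z : ℝ × EuclideanSpace ℝ (Fin 3), cknAEss r z v ≤ I)
    {b : EuclideanSpace ℝ (Fin 3)} (hb : b ≠ 0) : v ≠ fun _ _ => b := by
  intro hv
  have hK : ‖b‖ₑ ^ 2 * volume (ball (0 : EuclideanSpace ℝ (Fin 3)) 1) ≠ 0 :=
    mul_ne_zero (pow_ne_zero _ (enorm_ne_zero.2 hb)) (measure_ball_pos volume _ one_pos).ne'
  obtain ⟨n, hn⟩ := ENNReal.exists_nat_mul_gt hK hI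
  have hr : (0 : ℝ) < n + 1 := by positivity
  have h := hA ((n : ℝ) + 1) hr (0, 0)
  rw [hv, cknAEss_const hr] at h
  have hge : (n : ℝ≥0∞) ≤ ENNReal.ofReal (((n : ℝ) + 1) ^ 2) := by
    rw [← ENNReal.ofReal_natCast n]
    exact ENNReal.ofReal_le_ofReal (by nlinarith)
  have hle : (n : ℝ≥0∞) * (‖b‖ₑ ^ 2 * volume (ball (0 : EuclideanSpace ℝ (Fin 3)) 1)) ≤
      ENNReal.ofReal (((n : ℝ) + 1) ^ 2) * (‖b‖ₑ ^ 2 * volume (ball (0 : EuclideanSpace ℝ (Fin 3)) 1)) := by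
    gcongr
  exact absurd ((hn.trans_le hle).trans_le h) (lt_irrefl I)

/-- **The pressure-free eternal profile of a Type-II blow-up is not a nonzero constant** (for a
finite bound `I`): the conclusion of `exists_eternalProfile_pressureFree_of_not_isTypeIBlowup` carries
`‖v(0,0)‖ ≥ 1/2` AND `v ≠ const`, i.e. the degeneration that killed the line `Sketch`
(`Cruxes/TypeIliouvilleNoTypeII/Lines/Sketch_dead.md`: constant streams) does not occur. [folklore] -/
theorem exists_eternalProfile_pressureFree_ne_const_of_not_isTypeIBlowup (hν : 0 < ν) (hT : 0 < T)
    (hmax : IsMaximalSmoothSolution ν 0 u p T) (hLH : IsLerayHopfOn T ν 0 (u 0) u)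
    (hdec : HasRapidSpatialDecay (u 0)) (hII : ¬ IsTypeIBlowup u T) {S₁ : ℝ} (hS₁ : S₁ < ν * T)
    {I : ℝ≥0∞} (hI : I ≠ ⊤)
    (hA : ∀ r : ℝ, 0 < r → ∀ z : ℝ × EuclideanSpace ℝ (Fin 3),
      parabolicCylinder r z ⊆ Ioo S₁ (ν * T) ×ˢ univ → cknAEss r z (timeRescale ν⁻¹ ν⁻¹ u) ≤ I)
    (hC : ∀ r : ℝ, 0 < r → ∀ z : ℝ × EuclideanSpace ℝ (Fin 3),
      parabolicCylinder r z ⊆ Ioo S₁ (ν * T) ×ˢ univ → cknC r z (timeRescale ν⁻¹ ν⁻¹ u) ≤ I)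
    (hE : ∀ r : ℝ, 0 < r → ∀ z : ℝ × EuclideanSpace ℝ (Fin 3),
      parabolicCylinder r z ⊆ Ioo S₁ (ν * T) ×ˢ univ →
      cknE r z (fun s y => fderiv ℝ (timeRescale ν⁻¹ ν⁻¹ u s) y) ≤ I) :
    ∃ v : ℝ → EuclideanSpace ℝ (Fin 3) → EuclideanSpace ℝ (Fin 3),
      ContDiff ℝ (⊤ : ℕ∞) (uncurry v) ∧ (∀ t, VectorCalculus.IsDivFree (v t)) ∧
      (∀ s t : ℝ, s < t → ∀ x, v t x = heatFlow (v s) (t - s) x - oseenDuhamel 1 s v v t x) ∧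
      (∀ t x, ‖v t x‖ ≤ 2) ∧ 1 / 2 ≤ ‖v 0 0‖ ∧
      (∀ r : ℝ, 0 < r → ∀ z : ℝ × EuclideanSpace ℝ (Fin 3),
        cknAEss r z v ≤ I ∧ cknC r z v ≤ I ∧ cknE r z (fun s y => fderiv ℝ (v s) y) ≤ I) ∧
      ∀ b : EuclideanSpace ℝ (Fin 3), v ≠ fun _ _ => b := by
  obtain ⟨v, hv, hdiv, hmild, hvbd, h0, hQ⟩ :=
    exists_eternalProfile_pressureFree_of_not_isTypeIBlowup hν hT hmax hLH hdec hII hS₁ hA hC hE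
  refine ⟨v, hv, hdiv, hmild, hvbd, h0, hQ, fun b hb => ?_⟩
  by_cases hb0 : b = 0
  · -- the zero constant is excluded by `‖v(0,0)‖ ≥ 1/2`
    rw [hb, hb0, norm_zero] at h0
    linarith
  · exact ne_const_of_cknAEss_le hI (fun r hr z => (hQ r hr z).1) hb0 hb

end Summit.NavierStokesRegularity.NavierStokesRegularity.Theorems.TypeIliouvilleNoTypeII.EternalSplit

end
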